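import Literature.NumberTheory.LFunctions.MertensSecondUpperChain
import HarnessLib

/-!
# RH-FREE kernel certificate — «nothing here bears on the truth of RH»
# Rosser–Schoenfeld's (3.18) below `3 659 203`: certified run, chunks 1–5

Topic: `Literature/NumberTheory/LFunctions`. Pure proof file (kernel computation; nothing is asserted, no
definition). Each `runK` evaluates `MertensSecondUpperChain.runD 15333` — `15333` steps of the upper chain of
`MertensSecondUpperChain.lean` along the prime table `ChainTable.table`, each certifying the primality of the next
entry `p'`, performing the comparison `cmp` for the old state (which gives
`Σ_{q ≤ x} 1/q < log log x + B + 1/(2 log² x)` on `[p, p') ∩ [286, ∞)`), and extending the enclosure of `log p'`,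
the lower bound of `log log p'` and the upper bound of the sum. This file: primes `3 → 974317`. The four files
`MertensSecondUpperChainRun1–4.lean` (chunks 1–17, primes `3 → 3659203`) cover Rosser–Schoenfeld's tabular range of
(3.18) up to Dusart's analytic threshold `3 594 641` (assembly: `MertensSecondUpperErrorBound.lean`). The expected
states were obtained by evaluating the same function compiled (`#eval` on the Lean farm, 2026-08-28; all 17
comparisons pass). `decide +kernel`, standard axioms only (`maxHeartbeats 0`; ≈ 30 s of kernel time per chunk).

## References
* J. B. Rosser, L. Schoenfeld, Illinois J. Math. 6 (1962), 64–94: Thm 5 (3.18), p. 70; Thm 20 and §8 p. 87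
  (the tabular range). [RosserSchoenfeld1962]
-/

namespace Literature.NumberTheory.LFunctions.MertensSecondUpperChainRun

open MertensSecondUpperChain

set_option maxHeartbeats 0 in
/-- **Chunk 1 of the certified upper run** (primes `3` to `167953`).
[cite: RosserSchoenfeld1962, Thm. 5 (3.18) and Thm. 20 (tabular range)] -/
theorem run1 :
    runD 15333
      initU =
    some ⟨167953, 14545117807108278801555194, 14545117807108754407928708,
        3007230996660612685221141, 3323552157583063708687283⟩ := by
  decide +kernel

set_option maxHeartbeats 0 in
/-- **Chunk 2 of the certified upper run** (primes `167953` to `358811`).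
[cite: RosserSchoenfeld1962, Thm. 5 (3.18) and Thm. 20 (tabular range)] -/
theorem run2 :
    runD 15333
      ⟨167953, 14545117807108278801555194, 14545117807108754407928708,
        3007230996660612685221141, 3323552157583063708687283⟩ =
    some ⟨358811, 15462827431324419163683070, 15462827431324894770484816,
        3081197335460988240775231, 3397543217224910529641660⟩ := by
  decide +kernel

set_option maxHeartbeats 0 in
/-- **Chunk 3 of the certified upper run** (primes `358811` to `559093`).
[cite: RosserSchoenfeld1962, Thm. 5 (3.18) and Thm. 20 (tabular range)] -/
theorem run3 :
    runD 15333
      ⟨358811, 15462827431324419163683070, 15462827431324894770484816,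
        3081197335460988240775231, 3397543217224910529641660⟩ =
    some ⟨559093, 15999010259644050177662852, 15999010259644525784873915,
        3122407135649707504154866, 3438632892307624236837586⟩ := by
  decide +kernel

set_option maxHeartbeats 0 in
/-- **Chunk 4 of the certified upper run** (primes `559093` to `764719`).
[cite: RosserSchoenfeld1962, Thm. 5 (3.18) and Thm. 20 (tabular range)] -/
theorem run4 :
    runD 15333
      ⟨559093, 15999010259644050177662852, 15999010259644525784873915,
        3122407135649707504154866, 3438632892307624236837586⟩ =
    some ⟨764719, 16377636902363883166446018, 16377636902364358774052418,
        3150683836533455107326694, 3466888198568224076154462⟩ := by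
  decide +kernel

set_option maxHeartbeats 0 in
/-- **Chunk 5 of the certified upper run** (primes `764719` to `974317`).
[cite: RosserSchoenfeld1962, Thm. 5 (3.18) and Thm. 20 (tabular range)] -/
theorem run5 :
    runD 15333
      ⟨764719, 16377636902363883166446018, 16377636902364358774052418,
        3150683836533455107326694, 3466888198568224076154462⟩ =
    some ⟨974317, 16670472908117788623345073, 16670472908118264231339505,
        3172108739028779049147925, 3488323133211273941413028⟩ := by
  decide +kernel

end Literature.NumberTheory.LFunctions.MertensSecondUpperChainRun
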